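import Summits.QuantumFields.YangMills.Theorems.BalabanLadderUVSeamRecColdWallBoxCeiling
import Summits.QuantumFields.YangMills.Theorems.BalabanLadderUVSeamRecClassicalResponseThermalFloorSplit
import Summits.QuantumFields.YangMills.Theorems.SubOnsetCeilings.Negative.CubeKernelLaplace
import Literature.MathematicalPhysics.QuantumLattice.BalabanRGHaarIterates
import HarnessLib

/-!
# Crux `UVSeamRec` (stmt-QuantumFields-20043), line «coldwall_pure»: the ∃-reference of the (DR) stub is pinned from BELOW —
# a (weak) POINTWISE cold-wall centre ceiling at every FIXED radius, and `2 − p q β ≤ 120(2R+3)⁴(34 + 6 log β)/β + C₁A₀/R⁴`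

Helper file (`--supports stmt-QuantumFields-20043`) of the LEAD seat `ym-spine-20043-p1` (gen 11), sequel of `…ColdWallBoxCeiling` (the cold-wall
box-average ceiling `kerE^{𝟙}_{β,Λ}(S_Λ) ≤ #P_Λ (34 + 6 log β)/β`) and of gen 10's `…ThermalFloorSplit` (`dirichletRate_ref_le`: the (DR) reference
satisfies `p q β ≤ 2 − 6/(24β+3) + C₁A₀/R⁴`).  Line «coldwall_pure» (ym-idea-10; idea-crit-9 PASS-WITH-PRICE) posits
`stub_dirichletRate : DirichletRateSU2` — the Dirichlet finite-size law of the cold-wall centre-plane mean with an ∃-quantified reference `p q β`.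

* `card_cubeEdges_le`, `card_plaquettesTouching_cubeEdges_le` — `#Λ ≤ 4b⁴` and `#P_Λ ≤ 120 b⁴` for the cube `(c, b)`;
* **`kerE_one_deficit_le_pointwise`** — the POINTWISE cold-wall ceiling at FIXED radius (Tier 3(a) of tempered-d1's memo, effective but growing with
  the cube): for `β ≥ 1`, every cube radius `R`, orientation `q.1 < q.2` and site `x`,
  `kerE^{𝟙}_{β,(x−R−1, 2R+3)}(2 − plane q x) ≤ 120 (2R+3)⁴ (34 + 6 log β)/β` (the centre deficit is one of the non-negative costs summed in `S_Λ`);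
  this is NOT the R-uniform centre ceiling (Tier 3, the content of `stub_coldWallSplit`'s technology class), only its fixed-scale shadow;
* **`dirichletRate_ref_ge`** — (DR) with constants `(C₁ > 0, A₀, β₁, ℓ₁, p)` forces, for `β ≥ β₁`, `β ≥ 1`, `1 ≤ R`, `R·uRec β ≤ ℓ₁`, `q.1 < q.2`:
  `2 − 120(2R+3)⁴(34 + 6 log β)/β − C₁A₀/R⁴ ≤ p q β`;  **`dirichletRate_two_sub_ref_mem_Icc`** — with gen 10's floor:
  `2 − p q β ∈ [6/(24β+3) − C₁A₀/R⁴, 120(2R+3)⁴(34 + 6 log β)/β + C₁A₀/R⁴]` for EVERY admissible `R` — so (optimising `R ≍ (β/log β)^{1/8}`)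
  `|2 − p q β| = O(√(C₁A₀ (1 + log β)/β))` and `2 − p q β ≳ 1/(4β)`: the (DR) reference, too, is the perturbative plaquette mean up to these
  hypothesis-free tolerances (the (RM) reference is pinned to `Θ(1/β)`, `…TorusCeilingPinning`).

HONEST FRAMING: necessary conditions on the ∃-witness of an OPEN stub of a candidate line; nothing of E0′, NT or the gap; not Clay.
-/

open MeasureTheory Finset
open Literature.MathematicalPhysics.QuantumFieldTheory (LatticeRep)
open Literature.MathematicalPhysics.QuantumLattice (fundamentalLatticeRep fundamentalRep LGConfig ZdEdge plaquettesTouching wilsonBoundaryAction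
  isProbabilityMeasure_ymSpecification continuous_wilsonBoundaryAction)
open Summit.QuantumFields.YangMills.Cruxes.OSLegsFromFemtoAndGap.DlrCollarTransfer
open Summit.QuantumFields.YangMills.Theorems.OSLegsFromFemtoAndGap.StubLower (integrable_of_continuous_compact)
open Summit.QuantumFields.YangMills.Theorems.SubOnsetCeilings.Negative (centre_defect_le_wilsonBoundaryAction)

noncomputable section

namespace Summit.QuantumFields.YangMills.Cruxes.UVSeamRec.ClassicalResponse.ThermalFloor

/-! ### Counting the cube -/

/-- The cube `(c, b)` of `ℤ⁴` has `b⁴` sites. [folklore] -/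
theorem card_cubeSites (c : Fin 4 → ℤ) (b : ℕ) : (cubeSites c b).card = b ^ 4 := by
  unfold cubeSites
  rw [Fintype.card_piFinset]
  have h : ∀ i : Fin 4, (Finset.Ico (c i) (c i + b)).card = b := fun i => by
    rw [Int.card_Ico]; simp
  simp_rw [h]
  rw [Finset.prod_const, Finset.card_univ, Fintype.card_fin]

/-- The cube `(c, b)` has at most `4b⁴` interior links. [folklore] -/
theorem card_cubeEdges_le (c : Fin 4 → ℤ) (b : ℕ) : (cubeEdges c b).card ≤ 4 * b ^ 4 := by
  unfold cubeEdges
  refine (Finset.card_filter_le _ _).trans ?_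
  rw [Finset.card_product, card_cubeSites, Finset.card_univ, Fintype.card_fin, mul_comm]

/-- At most `120 b⁴` plaquettes touch the cube `(c, b)` (`#P_Λ ≤ 5 · 6 · #Λ`, `BalabanRGHaarIterates.card_plaquettesTouching_le`). [folklore] -/
theorem card_plaquettesTouching_cubeEdges_le (c : Fin 4 → ℤ) (b : ℕ) : (plaquettesTouching (cubeEdges c b)).card ≤ 120 * b ^ 4 := by
  have h := Literature.MathematicalPhysics.QuantumLattice.card_plaquettesTouching_le (cubeEdges c b)
  have h6 : Fintype.card {p : Fin 4 × Fin 4 // p.1 < p.2} = 6 := by decide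
  rw [h6] at h
  have h2 := card_cubeEdges_le c b
  calc (plaquettesTouching (cubeEdges c b)).card ≤ (1 + 4) * 6 * (cubeEdges c b).card := h
    _ ≤ (1 + 4) * 6 * (4 * b ^ 4) := Nat.mul_le_mul_left _ h2
    _ = 120 * b ^ 4 := by ring

/-! ### The pointwise cold-wall ceiling at fixed radius -/

section Pointwise

variable (G : Type) [Group G] [TopologicalSpace G] [IsTopologicalGroup G] [CompactSpace G] [MeasurableSpace G] [BorelSpace G]
  (r : LatticeRep G)

/-- **The centre deficit is dominated by the mean boundary action**: for every exterior `η`, cube `(x − R − 1, 2R+3)` and `q.1 < q.2`,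
`kerE^η(N − plane q x) ≤ kerE^η(S_Λ)` (the centre plaquette is one of the non-negative costs of `S_Λ`). [folklore] -/
theorem kerE_deficit_le_kerE_wilsonBoundaryAction (β : ℝ) {q : Fin 4 × Fin 4} (hq : q.1 < q.2) (x : Fin 4 → ℤ) (R : ℕ) (η : LGConfig 4 G) :
    kerE G r β (fun k => x k - (R + 1)) (2 * R + 3) η (fun U => (r.N : ℝ) - plane G r q x U) ≤
      kerE G r β (fun k => x k - (R + 1)) (2 * R + 3) η (wilsonBoundaryAction r.ρ (cubeEdges (fun k => x k - (R + 1)) (2 * R + 3))) := by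
  haveI := r.secondCountableTopology
  haveI := isProbabilityMeasure_ymSpecification r.ρ r.continuous β (cubeEdges (fun k => x k - (R + 1)) (2 * R + 3)) η
  unfold kerE
  exact integral_mono (integrable_of_continuous_compact (continuous_const.sub (continuous_plane r q x)))
    (integrable_of_continuous_compact (continuous_wilsonBoundaryAction r.ρ r.continuous _))
    fun U => centre_defect_le_wilsonBoundaryAction r hq x R U

end Pointwise

/-- **THE POINTWISE COLD-WALL CEILING AT FIXED RADIUS (`SU(2)`).**  For `β ≥ 1`, every radius `R`, orientation `q.1 < q.2` and site `x`, under the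
cold-wall kernel of the cube `(x − R − 1, 2R+3)`:
`kerE^{𝟙}_{β}(2 − plane q x) ≤ 120 (2R+3)⁴ · (34 + 6 log β)/β` — effective at every FIXED scale, growing like `R⁴` (not the R-uniform Tier 3). [folklore] -/
theorem kerE_one_deficit_le_pointwise {β : ℝ} (hβ : 1 ≤ β) (R : ℕ) (q : Fin 4 × Fin 4) (hq : q.1 < q.2) (x : Fin 4 → ℤ) :
    kerE (Matrix.specialUnitaryGroup (Fin 2) ℂ) (fundamentalLatticeRep 2) β (fun k => x k - (R + 1)) (2 * R + 3) (fun _ => 1)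
        (fun U => 2 - plane (Matrix.specialUnitaryGroup (Fin 2) ℂ) (fundamentalLatticeRep 2) q x U) ≤
      120 * ((2 * R + 3 : ℕ) : ℝ) ^ 4 * ((34 + 6 * Real.log β) / β) := by
  have h1 : kerE (Matrix.specialUnitaryGroup (Fin 2) ℂ) (fundamentalLatticeRep 2) β (fun k => x k - (R + 1)) (2 * R + 3) (fun _ => 1)
        (fun U => 2 - plane (Matrix.specialUnitaryGroup (Fin 2) ℂ) (fundamentalLatticeRep 2) q x U) ≤
      kerE (Matrix.specialUnitaryGroup (Fin 2) ℂ) (fundamentalLatticeRep 2) β (fun k => x k - (R + 1)) (2 * R + 3) (fun _ => 1)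
        (wilsonBoundaryAction (fundamentalRep (Fin 2)) (cubeEdges (fun k => x k - (R + 1)) (2 * R + 3))) := by
    have h := kerE_deficit_le_kerE_wilsonBoundaryAction (Matrix.specialUnitaryGroup (Fin 2) ℂ) (fundamentalLatticeRep 2) β hq x R (fun _ => 1)
    have hN : ((fundamentalLatticeRep 2).N : ℝ) = 2 := by simp
    simp only [hN] at h
    exact h
  have h2 := kerE_one_wilsonBoundaryAction_le_card_mul (fun k => x k - (R + 1)) (2 * R + 3) hβ
  have h3 : ((plaquettesTouching (cubeEdges (fun k => x k - ((R : ℤ) + 1)) (2 * R + 3))).card : ℝ) ≤ 120 * ((2 * R + 3 : ℕ) : ℝ) ^ 4 := by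
    have := card_plaquettesTouching_cubeEdges_le (fun k => x k - ((R : ℤ) + 1)) (2 * R + 3)
    exact_mod_cast this
  have hβ0 : 0 < β := by linarith
  have hpos : 0 ≤ (34 + 6 * Real.log β) / β := div_nonneg (by linarith [Real.log_nonneg hβ]) hβ0.le
  exact h1.trans (h2.trans (mul_le_mul_of_nonneg_right h3 hpos))

/-! ### The (DR) reference is pinned from below -/

/-- **(DR) pins its reference value from BELOW.**  If `DirichletRate C₁ A₀ β₁ ℓ₁ p` with `C₁ > 0`, then for `β ≥ β₁`, `β ≥ 1`, `1 ≤ R`,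
`R·uRec β ≤ ℓ₁` and `q.1 < q.2`: `2 − 120(2R+3)⁴(34 + 6 log β)/β − C₁A₀/R⁴ ≤ p q β` (the fixed-radius pointwise cold-wall ceiling plus the (DR)
tolerance `|kerE^{𝟙}(plane q x) − p q β| ≤ C₁A₀/R⁴`). [folklore] -/
theorem dirichletRate_ref_ge {C₁ A₀ β₁ ℓ₁ : ℝ} {p : Fin 4 × Fin 4 → ℝ → ℝ} (h : DirichletRate C₁ A₀ β₁ ℓ₁ p) (hC₁ : 0 < C₁)
    {β : ℝ} (hβ₁ : β₁ ≤ β) (hβ : 1 ≤ β) {R : ℕ} (hR : 1 ≤ R) (hRu : (R : ℝ) * Transport.uRec β ≤ ℓ₁)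
    (q : Fin 4 × Fin 4) (hq : q.1 < q.2) :
    2 - 120 * ((2 * R + 3 : ℕ) : ℝ) ^ 4 * ((34 + 6 * Real.log β) / β) - C₁ * A₀ / (R : ℝ) ^ 4 ≤ p q β := by
  have h2 := abs_sub_le_of_dirichletRate hC₁ h hβ₁ hR hRu q hq 0
  have h3 := kerE_one_deficit_le_pointwise hβ R q hq 0
  have hone : (fun _ : ZdEdge 4 => (1 : Matrix.specialUnitaryGroup (Fin 2) ℂ)) = (1 : LGConfig 4 (Matrix.specialUnitaryGroup (Fin 2) ℂ)) := rfl
  rw [hone, kerE_const_sub (fundamentalLatticeRep 2) β _ _ 1 (continuous_plane (fundamentalLatticeRep 2) q 0)] at h3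
  have h4 := (abs_le.1 h2).2
  push_cast at h3 h4 ⊢
  linarith

/-- **The (DR) reference is the perturbative plaquette mean, up to hypothesis-free tolerances.**  Under `DirichletRate C₁ A₀ β₁ ℓ₁ p` (`C₁ > 0`),
for `β ≥ β₁`, `β ≥ 1`, `1 ≤ R`, `R·uRec β ≤ ℓ₁`, `q.1 < q.2`:
`2 − p q β ∈ [6/(24β+3) − C₁A₀/R⁴, 120(2R+3)⁴(34 + 6 log β)/β + C₁A₀/R⁴]` (gen 10's `dirichletRate_ref_le` and `dirichletRate_ref_ge`).
[folklore] -/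
theorem dirichletRate_two_sub_ref_mem_Icc {C₁ A₀ β₁ ℓ₁ : ℝ} {p : Fin 4 × Fin 4 → ℝ → ℝ} (h : DirichletRate C₁ A₀ β₁ ℓ₁ p) (hC₁ : 0 < C₁)
    {β : ℝ} (hβ₁ : β₁ ≤ β) (hβ : 1 ≤ β) {R : ℕ} (hR : 1 ≤ R) (hRu : (R : ℝ) * Transport.uRec β ≤ ℓ₁)
    (q : Fin 4 × Fin 4) (hq : q.1 < q.2) :
    2 - p q β ∈ Set.Icc (6 / (24 * β + 3) - C₁ * A₀ / (R : ℝ) ^ 4)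
      (120 * ((2 * R + 3 : ℕ) : ℝ) ^ 4 * ((34 + 6 * Real.log β) / β) + C₁ * A₀ / (R : ℝ) ^ 4) := by
  have h1 := dirichletRate_ref_ge h hC₁ hβ₁ hβ hR hRu q hq
  have h2 := dirichletRate_ref_le h hC₁ hβ₁ (by linarith) hR hRu q hq
  exact ⟨by linarith, by linarith⟩

end Summit.QuantumFields.YangMills.Cruxes.UVSeamRec.ClassicalResponse.ThermalFloor

end
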